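import Mathlib
import Literature.NumberTheory.Transcendental.KZProductIdeal
import Summits.KontsevichZagierPeriods.KontsevichZagierPeriods.Theorems.InverseLandauTateLiftingAxialEngine
import Summits.KontsevichZagierPeriods.KontsevichZagierPeriods.Theorems.InverseLandauTateLiftingCubeTriangulation
import Summits.KontsevichZagierPeriods.KontsevichZagierPeriods.Theorems.InverseLandauTateLiftingSimplexValue
import Summits.KontsevichZagierPeriods.KontsevichZagierPeriods.Theorems.InverseLandauTateLiftingPolytopeSector
import Summits.KontsevichZagierPeriods.KontsevichZagierPeriods.Theorems.InverseLandauTateLiftingRotationSector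
import Summits.KontsevichZagierPeriods.KontsevichZagierPeriods.Theorems.InverseLandauTateLiftingRotationSplit

/-!
# `TateLifting` (stmt-KontsevichZagierPeriods-9129), line `Sketch` — THE AXIAL SECTOR, CUBES AS POLYTOPES, SIMPLEX VOLUMES

Assembly of stubs 59–61 of the line (`tateLifting_axialEngine`, `tateLifting_cubeTriangulation`, `tateLifting_simplexValue`):

* `axialKernel`, `TateLifting_axialSector` — **AXIAL KERNEL TRANSFER** with no transcendence input: representations over `ℝ⁷`
  invariant under the simultaneous rotations of the coordinate pairs `(1,2)`, `(4,5)` (rotation about the `z`-axis of two points of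
  `ℝ³` with a spectator `ρ` — the residual symmetry of a three-body configuration after the space engine `space_engine`) whose
  honest AXIAL MERIDIAN (over `{v ∈ ℝ⁶ | v 0 > 0, (v 1, v 0, 0, v 2, …, v 5) ∈ τ}`, integrand `2 v₀ · f(…)`) reduces to a kernel
  sector `closure S`, generate a kernel sector (`⟦t⟧ = ⟦meridian⟧·⟦π⟧`, the common factor `π ≠ 0` cancels). With `spaceKernel` this
  quotients the full `SO(3)`-symmetry (`8π² = 4π · 2π`) of the Mayer diagrams of route HardSphereVirial.
* `cube_mem_simplexSpan` — the open unit cube `(0,1)ⁿ` with a `K`-polynomial integrand lies in the span of the simplex generators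
  modulo relations (triangulation by the `n!` permuted ordered simplices); `kzPeriodConjecture_cube_simplex` — **the unit `n`-cube and
  every real-algebraic `m`-simplex of volume `1` are KZ-equivalent** (Hilbert's cube–tetrahedron pair, across dimensions).
* `kzPeriodConjecture_simplex_det` — two integrand-`1` simplices `A(Δ_n)+b`, `A′(Δ_m)+b′` with `|det A|/n! = |det A′|/m!` are
  KZ-equivalent (the value hypothesis of `kzPeriodConjecture_simplex` made explicit by `tateLifting_simplexValue`).

Design: no definitions. References: M. Kontsevich, D. Zagier, *Periods* (2001), §§1.2, 4.1.
-/

noncomputable section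

namespace Summit.KontsevichZagierPeriods.InverseLandau

open MeasureTheory Set
open Literature.NumberTheory.Transcendental

/-- **AXIAL KERNEL TRANSFER.** Let `S`, `B` be sets of formal combinations such that every element of `B` is the class of a
representation `t` over `ℝ⁷` invariant (domain and integrand) under the simultaneous rotations of the pairs `(1,2)`, `(4,5)`, together
with an honest axial meridian `m` over `{v | v 0 > 0, (v 1, v 0, 0, v 2, v 3, v 4, v 5) ∈ t.domain}` with integrand
`2 v₀ · t.integrand (v 1, v 0, 0, v 2, …)` there, reducing to `closure S` modulo relations. If Conjecture 1 (kernel form) holds on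
`closure S`, it holds on `closure B` (`tateLifting_axialEngine` on the honest product `[ℝ, du/(1+u²)] × m`, `PiNormalisation`,
`RotationSector.kernel_of_reduce_mul`). [cite: KontsevichZagier2001, §1.2] -/
theorem axialKernel (S B : Set KZ.FormalRep)
    (hB : ∀ d ∈ B, ∃ (t : KZ.IntegralRep 7) (m : KZ.IntegralRep 6),
      (∀ p ∈ t.domain, ∀ c s : ℝ, c ^ 2 + s ^ 2 = 1 →
        (![p 0, c * p 1 - s * p 2, s * p 1 + c * p 2, p 3, c * p 4 - s * p 5, s * p 4 + c * p 5, p 6] : Fin 7 → ℝ) ∈ t.domain ∧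
        t.integrand (![p 0, c * p 1 - s * p 2, s * p 1 + c * p 2, p 3, c * p 4 - s * p 5, s * p 4 + c * p 5, p 6] : Fin 7 → ℝ) =
          t.integrand p) ∧
      m.domain = {v | 0 < v 0 ∧ (![v 1, v 0, 0, v 2, v 3, v 4, v 5] : Fin 7 → ℝ) ∈ t.domain} ∧
      Set.EqOn m.integrand (fun v => 2 * v 0 * t.integrand (![v 1, v 0, 0, v 2, v 3, v 4, v 5] : Fin 7 → ℝ)) m.domain ∧
      (∃ ℓ ∈ AddSubgroup.closure S, KZ.of m - ℓ ∈ KZ.relations) ∧ d = KZ.of t)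
    (hK : ∀ c ∈ AddSubgroup.closure S, KZ.eval c = 0 → c ∈ KZ.relations) :
    ∀ c ∈ AddSubgroup.closure B, KZ.eval c = 0 → c ∈ KZ.relations := by
  refine RotationSector.kernel_of_reduce_mul (KZ.of KZ.piRep) (by rw [KZ.eval_of_piRep]; exact Real.pi_ne_zero)
    (fun d hd => ?_) hK
  obtain ⟨t, m, hinv, hmd, hmi, ⟨ℓ, hℓ, hmℓ⟩, rfl⟩ := hB d hd
  obtain ⟨c, hcd, hci⟩ := RotationSplit.exists_arctanRep_univ
  refine ⟨ℓ, hℓ, ?_⟩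
  have hq := tateLifting_axialEngine t hinv (c.prod m) ?_ ?_
  · have h1 : KZ.of (c.prod m) - KZ.of m * KZ.of c ∈ KZ.relations := by
      rw [← KZ.of_mul_of]; exact KZ.mul_sub_mul_comm_mem_relations _ _
    have h2 : KZ.of m * KZ.of c - KZ.of m * KZ.of KZ.piRep ∈ KZ.relations := by
      rw [← mul_sub]; exact KZ.of_mul_mem_relations m (RotationSector.arctan_sub_piRep_mem_relations c hcd hci)
    have h3 : KZ.of m * KZ.of KZ.piRep - ℓ * KZ.of KZ.piRep ∈ KZ.relations := by
      rw [← sub_mul]; exact KZ.mul_mem_relations_right_holds _ _ hmℓ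
    have : KZ.of t - ℓ * KZ.of KZ.piRep = (KZ.of t - KZ.of (c.prod m)) +
        (KZ.of (c.prod m) - KZ.of m * KZ.of c) + (KZ.of m * KZ.of c - KZ.of m * KZ.of KZ.piRep) +
        (KZ.of m * KZ.of KZ.piRep - ℓ * KZ.of KZ.piRep) := by abel
    rw [this]
    exact KZ.relations.add_mem (KZ.relations.add_mem (KZ.relations.add_mem hq h1) h2) h3
  · rw [KZ.IntegralRep.prod_domain]
    ext w
    simp only [KZ.IntegralRep.mem_prodDomain, hcd, Set.mem_univ, true_and, hmd, Set.mem_setOf_eq]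
    rfl
  · intro w hw
    rw [KZ.IntegralRep.prod_integrand_eq, KZ.IntegralRep.prodFun_apply, hci]
    rw [KZ.IntegralRep.prod_domain, KZ.IntegralRep.mem_prodDomain] at hw
    rw [hmi hw.2]
    show (1 : ℝ) / (1 + w 0 ^ 2) * (2 * w 1 * t.integrand (![w 2, w 1, 0, w 3, w 4, w 5, w 6] : Fin 7 → ℝ)) =
      2 / (1 + w 0 ^ 2) * w 1 * t.integrand (![w 2, w 1, 0, w 3, w 4, w 5, w 6] : Fin 7 → ℝ)
    ring

/-- **The crux `TateLifting` on the axial images of a kernel sector** (in fact inside `KZ.relations`). [cite: KontsevichZagier2001, §1.2] -/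
theorem TateLifting_axialSector (S B : Set KZ.FormalRep)
    (hB : ∀ d ∈ B, ∃ (t : KZ.IntegralRep 7) (m : KZ.IntegralRep 6),
      (∀ p ∈ t.domain, ∀ c s : ℝ, c ^ 2 + s ^ 2 = 1 →
        (![p 0, c * p 1 - s * p 2, s * p 1 + c * p 2, p 3, c * p 4 - s * p 5, s * p 4 + c * p 5, p 6] : Fin 7 → ℝ) ∈ t.domain ∧
        t.integrand (![p 0, c * p 1 - s * p 2, s * p 1 + c * p 2, p 3, c * p 4 - s * p 5, s * p 4 + c * p 5, p 6] : Fin 7 → ℝ) =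
          t.integrand p) ∧
      m.domain = {v | 0 < v 0 ∧ (![v 1, v 0, 0, v 2, v 3, v 4, v 5] : Fin 7 → ℝ) ∈ t.domain} ∧
      Set.EqOn m.integrand (fun v => 2 * v 0 * t.integrand (![v 1, v 0, 0, v 2, v 3, v 4, v 5] : Fin 7 → ℝ)) m.domain ∧
      (∃ ℓ ∈ AddSubgroup.closure S, KZ.of m - ℓ ∈ KZ.relations) ∧ d = KZ.of t)
    (hK : ∀ c ∈ AddSubgroup.closure S, KZ.eval c = 0 → c ∈ KZ.relations) (T : Set KZ.FormalRep) :
    ∀ c ∈ AddSubgroup.closure B, KZ.eval c = 0 → c ∈ KZ.relations ⊔ AddSubgroup.closure T :=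
  fun c hc h0 => AddSubgroup.mem_sup_left (axialKernel S B hB hK c hc h0)

/-- **CUBES ARE POLYTOPES**: a representation over the open unit cube `(0,1)ⁿ` with a `K`-polynomial integrand lies in the span of the
simplex generators modulo relations (the triangulation `tateLifting_cubeTriangulation` by the `n!` permuted ordered simplices — permutation
matrices have entries `0, 1` and determinant `±1` — and iterated domain additivity `Polytope.covered_reduce`'s pattern).
[cite: KontsevichZagier2001, §1.2 rule (1)] -/
theorem cube_mem_simplexSpan {n : ℕ} (r : KZ.IntegralRep n) (P : MvPolynomial (Fin n) (algebraicClosure ℚ ℝ))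
    (hd : r.domain = Set.pi Set.univ (fun _ => Set.Ioo (0 : ℝ) 1))
    (hi : Set.EqOn r.integrand (fun z => (MvPolynomial.aeval z P : ℝ)) r.domain) :
    ∃ ℓ ∈ AddSubgroup.closure
      {d : KZ.FormalRep | ∃ (n : ℕ) (A : Matrix (Fin n) (Fin n) ℝ) (b : Fin n → ℝ)
            (P : MvPolynomial (Fin n) (algebraicClosure ℚ ℝ)) (r : KZ.IntegralRep n),
          (∀ i j, IsAlgebraic ℚ (A i j)) ∧ (∀ i, IsAlgebraic ℚ (b i)) ∧ A.det ≠ 0 ∧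
          r.domain = (fun x => A.mulVec x + b) '' KZ.openOrderedSimplex n ∧
          Set.EqOn r.integrand (fun z => (MvPolynomial.aeval z P : ℝ)) r.domain ∧ d = KZ.of r},
      KZ.of r - ℓ ∈ KZ.relations := by
  classical
  obtain ⟨R, hRd, hRi, hRsub, hcov, hdisj⟩ := tateLifting_cubeTriangulation n r hd
  have hgen : ∀ σ : Equiv.Perm (Fin n), KZ.of (R σ) ∈
      {d : KZ.FormalRep | ∃ (n : ℕ) (A : Matrix (Fin n) (Fin n) ℝ) (b : Fin n → ℝ)
            (P : MvPolynomial (Fin n) (algebraicClosure ℚ ℝ)) (r : KZ.IntegralRep n),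
          (∀ i j, IsAlgebraic ℚ (A i j)) ∧ (∀ i, IsAlgebraic ℚ (b i)) ∧ A.det ≠ 0 ∧
          r.domain = (fun x => A.mulVec x + b) '' KZ.openOrderedSimplex n ∧
          Set.EqOn r.integrand (fun z => (MvPolynomial.aeval z P : ℝ)) r.domain ∧ d = KZ.of r} := by
    intro σ
    refine ⟨n, (Equiv.Perm.permMatrix ℝ σ : Matrix (Fin n) (Fin n) ℝ), 0, P, R σ, fun i j => ?_, fun _ => isAlgebraic_zero,
      ?_, hRd σ, fun x hx => ?_, rfl⟩
    · rw [Equiv.Perm.permMatrix, PEquiv.toMatrix_apply]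
      split_ifs
      · exact isAlgebraic_one
      · exact isAlgebraic_zero
    · rw [Matrix.det_permutation]
      exact Int.cast_ne_zero.mpr (Units.ne_zero _)
    · rw [hRi]; exact hi (hRsub σ hx)
  refine ⟨∑ σ ∈ Finset.univ, KZ.of (R σ), sum_mem fun σ _ => AddSubgroup.subset_closure (hgen σ),
    KZ.of_sub_sum_of_mem_relations Finset.univ r R
      (fun σ _ => by rw [Set.sdiff_eq_empty.mpr (hRsub σ), measure_empty]) (fun σ _ x hx => by rw [hRi]) hcov hdisj⟩

/-- **The unit `n`-cube and every real-algebraic `m`-simplex of volume `1` are KZ-equivalent** (Hilbert's cube–tetrahedron pair, across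
dimensions: volume is the only invariant of the four moves). [cite: KontsevichZagier2001, §1.2] -/
theorem kzPeriodConjecture_cube_simplex {n m : ℕ} (r : KZ.IntegralRep n) (r' : KZ.IntegralRep m)
    (A' : Matrix (Fin m) (Fin m) ℝ) (b' : Fin m → ℝ)
    (hd : r.domain = Set.pi Set.univ (fun _ => Set.Ioo (0 : ℝ) 1)) (hri : ∀ y ∈ r.domain, r.integrand y = 1)
    (hAa' : ∀ i j, IsAlgebraic ℚ (A' i j)) (hba' : ∀ i, IsAlgebraic ℚ (b' i)) (hdet' : A'.det ≠ 0)
    (hdom' : r'.domain = (fun x => A'.mulVec x + b') '' KZ.openOrderedSimplex m) (hri' : ∀ y ∈ r'.domain, r'.integrand y = 1)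
    (hvol : |A'.det| / m.factorial = 1) : KZ.Equivalent r r' := by
  obtain ⟨ℓ, hℓ, hrel⟩ := cube_mem_simplexSpan r 1 hd (fun y hy => by
    show r.integrand y = MvPolynomial.aeval y 1
    rw [hri y hy, map_one])
  have hgen' : KZ.of r' ∈
      {d : KZ.FormalRep | ∃ (n : ℕ) (A : Matrix (Fin n) (Fin n) ℝ) (b : Fin n → ℝ)
            (P : MvPolynomial (Fin n) (algebraicClosure ℚ ℝ)) (r : KZ.IntegralRep n),
          (∀ i j, IsAlgebraic ℚ (A i j)) ∧ (∀ i, IsAlgebraic ℚ (b i)) ∧ A.det ≠ 0 ∧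
          r.domain = (fun x => A.mulVec x + b) '' KZ.openOrderedSimplex n ∧
          Set.EqOn r.integrand (fun z => (MvPolynomial.aeval z P : ℝ)) r.domain ∧ d = KZ.of r} :=
    ⟨m, A', b', 1, r', hAa', hba', hdet', hdom', fun y hy => by
      show r'.integrand y = MvPolynomial.aeval y 1
      rw [hri' y hy, map_one], rfl⟩
  have hmem : ℓ - KZ.of r' ∈ AddSubgroup.closure (
      {d : KZ.FormalRep | ∃ (n : ℕ) (A : Matrix (Fin n) (Fin n) ℝ) (b : Fin n → ℝ)
            (P : MvPolynomial (Fin n) (algebraicClosure ℚ ℝ)) (r : KZ.IntegralRep n),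
          (∀ i j, IsAlgebraic ℚ (A i j)) ∧ (∀ i, IsAlgebraic ℚ (b i)) ∧ A.det ≠ 0 ∧
          r.domain = (fun x => A.mulVec x + b) '' KZ.openOrderedSimplex n ∧
          Set.EqOn r.integrand (fun z => (MvPolynomial.aeval z P : ℝ)) r.domain ∧ d = KZ.of r} ∪
        {d : KZ.FormalRep | ∃ r : KZ.IntegralRep 0, d = KZ.of r}) :=
    sub_mem (AddSubgroup.closure_mono Set.subset_union_left hℓ)
      (AddSubgroup.subset_closure (Or.inl hgen'))
  -- values: `vol (0,1)ⁿ = 1 = |det A′|/m!`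
  have hvr : r.value = 1 := by
    unfold KZ.IntegralRep.value
    rw [setIntegral_congr_fun (KZ.IntegralRep.measurableSet_domain_holds r) hri, hd]
    simp [Real.volume_Ioo, measureReal_def, volume_pi_pi]
  have hvr' : r'.value = 1 := by rw [tateLifting_simplexValue m A' b' r' hdom' hri', hvol]
  have hev : KZ.eval (ℓ - KZ.of r') = 0 := by
    have h1 := KZ.relations_le_ker_eval_holds hrel
    rw [AddMonoidHom.mem_ker, map_sub, KZ.eval_of, hvr] at h1
    rw [map_sub, KZ.eval_of, hvr']
    linarith
  have hker := simplexKernel _ hmem hev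
  show KZ.of r - KZ.of r' ∈ KZ.relations
  have : KZ.of r - KZ.of r' = (KZ.of r - ℓ) + (ℓ - KZ.of r') := by abel
  rw [this]
  exact KZ.relations.add_mem hrel hker

/-- **Two integrand-`1` simplices with `|det A|/n! = |det A′|/m!` (real-algebraic data, any two dimensions) are KZ-equivalent.**
[cite: KontsevichZagier2001, §1.2] -/
theorem kzPeriodConjecture_simplex_det :
    ∀ {n m : ℕ} (A : Matrix (Fin n) (Fin n) ℝ) (b : Fin n → ℝ) (A' : Matrix (Fin m) (Fin m) ℝ) (b' : Fin m → ℝ)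
      (r : KZ.IntegralRep n) (r' : KZ.IntegralRep m),
      (∀ i j, IsAlgebraic ℚ (A i j)) → (∀ i, IsAlgebraic ℚ (b i)) → A.det ≠ 0 →
      r.domain = (fun x => A.mulVec x + b) '' KZ.openOrderedSimplex n → (∀ y ∈ r.domain, r.integrand y = 1) →
      (∀ i j, IsAlgebraic ℚ (A' i j)) → (∀ i, IsAlgebraic ℚ (b' i)) → A'.det ≠ 0 →
      r'.domain = (fun x => A'.mulVec x + b') '' KZ.openOrderedSimplex m → (∀ y ∈ r'.domain, r'.integrand y = 1) →
      |A.det| / n.factorial = |A'.det| / m.factorial → KZ.Equivalent r r' := by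
  intro n m A b A' b' r r' hAa hba hdet hdom hri hAa' hba' hdet' hdom' hri' hv
  refine kzPeriodConjecture_simplex r r' A b (1 : MvPolynomial (Fin n) (algebraicClosure ℚ ℝ)) A' b' 1 hAa hba hdet hdom
    (fun y hy => by show r.integrand y = MvPolynomial.aeval y 1; rw [hri y hy, map_one]) hAa' hba' hdet' hdom'
    (fun y hy => by show r'.integrand y = MvPolynomial.aeval y 1; rw [hri' y hy, map_one]) ?_
  rw [tateLifting_simplexValue n A b r hdom hri, tateLifting_simplexValue m A' b' r' hdom' hri', hv]

end Summit.KontsevichZagierPeriods.InverseLandau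

end
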